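import Mathlib.Analysis.Calculus.Deriv.Add
import Mathlib.Analysis.Calculus.Deriv.Mul
import Mathlib.Analysis.Calculus.Deriv.Pow
import Mathlib.Analysis.Calculus.Deriv.Shift
import Mathlib.Analysis.Complex.RealDeriv
import Literature.MathematicalPhysics.QuantumLattice.GrassmannGaussianMeasureChange
import HarnessLib

/-!
# Source derivatives of Gaussian Berezin functionals (bilinear insertions)

Topic `Literature/MathematicalPhysics/QuantumLattice`; companion of `GrassmannGaussianMeasureChange.lean`
(`e^{ψ̄(A+N)ψ} = e^{ψ̄Aψ} e^{ψ̄Nψ}` for the central nilpotent quadratic actions `ψ̄Aψ = quadratic R A`).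
The SOURCE TRICK of fermionic perturbation theory (Berezin 1966, Ch. I §3; Montvay–Münster 1994, §4.1:
expectation values of products of Grassmann variables are derivatives of the generating Gaussian integral
with respect to the sources), in the bilinear form behind the Feynman–Hellmann theorem: the insertion of the
bilinear `ψ̄Jψ = quadratic J` into a Gaussian Berezin functional is the derivative in the strength `s` of
the source term `s ψ̄Jψ` added to the action,

  `d/ds|_{s=0} φ (X e^{ψ̄(A + sJ)ψ}) = φ (X ψ̄Jψ e^{ψ̄Aψ})`,

for EVERY linear functional `φ` on the complex-fermion Grassmann algebra (the Berezin integral `∫dψ̄dψ`, a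
coefficient functional, `y ↦ ∫ X' y`, …), every element `X` (further insertions ride along) and all
matrices `A` (action) and `J` (source).  The proof is finite-dimensional algebra: `ψ̄Jψ` is central and
nilpotent, `(ψ̄Jψ)^K = 0`, so `e^{ψ̄(A+sJ)ψ} = e^{ψ̄Aψ} Σ_{i<K} sⁱ (ψ̄Jψ)ⁱ / i!` and
`s ↦ φ (X e^{ψ̄(A+sJ)ψ})` is a polynomial in `s` with coefficients `φ (X e^{ψ̄Aψ} (ψ̄Jψ)ⁱ) / i!`, whose
linear coefficient is the derivative at `0`.

## Main results

* `grassmannExp_smul_eq_sum` — `σ ^ K = 0 ⟹ exp (c • σ) = Σ_{i<K} (i!)⁻¹ • cⁱ • σⁱ` over any commutative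
  `ℚ`-algebra of coefficients; `grassmannExp_smul_eq_sum_field` — the same with the field scalars
  `((i!)⁻¹ cⁱ) • σⁱ`;
* `apply_mul_grassmannExp_smul_eq_sum` — `φ (Y exp (c • σ)) = Σ_{i<K} (i!)⁻¹ cⁱ φ (Y σⁱ)` for a linear
  functional `φ` (linear exchange);
* `hasDerivAt_apply_mul_grassmannExp_smul_zero` — `d/ds|₀ φ (Y exp (s • σ)) = φ (Y σ)` for nilpotent `σ`,
  over a nontrivially normed field of coefficients;
* `hasDerivAt_apply_mul_grassmannExp_quadratic_add_smul_zero` /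
  `hasDerivAt_apply_mul_grassmannExp_quadratic_add_smul` — **the source derivative**
  `d/ds φ (X e^{ψ̄(A+sJ)ψ}) = φ (X ψ̄Jψ e^{ψ̄(A+s₀J)ψ})` at `s₀ = 0` / at every `s₀`, source strength in the
  scalar field;
* `hasDerivAt_apply_mul_grassmannExp_quadratic_add_ofReal_smul_zero` /
  `hasDerivAt_apply_mul_grassmannExp_quadratic_add_ofReal_smul` — the same over `ℂ` with a REAL source
  strength `s : ℝ` (`A + (s : ℂ) • J`), the form used by Feynman–Hellmann and transfer-matrix arguments.

Related: `GrassmannGaussianQuadraticNormalisation.lean` differentiates `s ↦ ∫ dμ_C e^{s q}` for the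
Laplacian-form expectation `gaussExpect` of a quadratic `q` in the generators of a plain Grassmann algebra;
here the functional is arbitrary, an insertion `X` is carried, and the quadratic element is the
complex-fermion bilinear `quadratic R J` on `ι ⊕ₗ ι`.

## Sources

F. A. Berezin, *The Method of Second Quantization* (Academic Press, 1966), Ch. I §3 (Gaussian integrals
over the Grassmann algebra, generating functionals); I. Montvay, G. Münster, *Quantum Fields on a
Lattice* (CUP, 1994), §4.1 (Grassmann integration with sources; expectation values as derivatives of
the generating function).  The one-parameter bilinear-source form `A ↦ A + sJ` is standard (no single
source).  Mathlib + `GrassmannGaussianMeasureChange.lean` only; no definitions, no named facts.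
-/

noncomputable section

namespace Literature.MathematicalPhysics.QuantumLattice

open GrassmannAlgebra

/-! ### The exponential of a scalar multiple of a nilpotent element as a finite sum -/

section CommRing

variable {R : Type*} [CommRing R] [Algebra ℚ R] {ι : Type*}

/-- For a nilpotent Grassmann element with `σ ^ K = 0` and a scalar `c`,
`exp (c • σ) = Σ_{i<K} (i!)⁻¹ • (cⁱ • σⁱ)` (the exponential series stops; `ℚ`-scalars as in
`IsNilpotent.exp`). [folklore] -/
theorem grassmannExp_smul_eq_sum {σ : GrassmannAlgebra R ι} {K : ℕ} (hK : σ ^ K = 0) (c : R) :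
    grassmannExp (c • σ) = ∑ i ∈ Finset.range K, (i.factorial : ℚ)⁻¹ • (c ^ i • σ ^ i) := by
  have h0 : (c • σ) ^ K = 0 := by rw [smul_pow, hK, smul_zero]
  rw [grassmannExp, IsNilpotent.exp_eq_sum h0]
  exact Finset.sum_congr rfl fun i _ => by rw [smul_pow]

end CommRing

section Field

variable {𝕜 : Type*} [Field 𝕜] [Algebra ℚ 𝕜] {ι : Type*}

/-- Over a field of coefficients: `σ ^ K = 0 ⟹ exp (c • σ) = Σ_{i<K} ((i!)⁻¹ cⁱ) • σⁱ`. [folklore] -/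
theorem grassmannExp_smul_eq_sum_field {σ : GrassmannAlgebra 𝕜 ι} {K : ℕ} (hK : σ ^ K = 0) (c : 𝕜) :
    grassmannExp (c • σ) = ∑ i ∈ Finset.range K, ((i.factorial : 𝕜)⁻¹ * c ^ i) • σ ^ i := by
  rw [grassmannExp_smul_eq_sum hK]
  exact Finset.sum_congr rfl fun i _ => by rw [inv_natCast_smul_eq ℚ 𝕜, smul_smul]

/-- **Linear exchange.** For a linear functional `φ`, an element `Y` and `σ ^ K = 0`:
`φ (Y exp (c • σ)) = Σ_{i<K} (i!)⁻¹ cⁱ φ (Y σⁱ)` — a polynomial in `c`. [folklore] -/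
theorem apply_mul_grassmannExp_smul_eq_sum (φ : GrassmannAlgebra 𝕜 ι →ₗ[𝕜] 𝕜) (Y : GrassmannAlgebra 𝕜 ι)
    {σ : GrassmannAlgebra 𝕜 ι} {K : ℕ} (hK : σ ^ K = 0) (c : 𝕜) :
    φ (Y * grassmannExp (c • σ)) =
      ∑ i ∈ Finset.range K, (i.factorial : 𝕜)⁻¹ * c ^ i * φ (Y * σ ^ i) := by
  rw [grassmannExp_smul_eq_sum_field hK, Finset.mul_sum, map_sum]
  exact Finset.sum_congr rfl fun i _ => by rw [mul_smul_comm, map_smul, smul_eq_mul]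

end Field

/-! ### Derivatives in the strength of a nilpotent exponent -/

section NormedField

variable {𝕜 : Type*} [NontriviallyNormedField 𝕜] [Algebra ℚ 𝕜] {ι : Type*}

/-- **`d/ds|₀ φ (Y exp (s • σ)) = φ (Y σ)`** for a linear functional `φ`, any `Y` and a nilpotent `σ`:
`s ↦ φ (Y exp (s • σ))` is the polynomial `Σ_{i<K} (i!)⁻¹ sⁱ φ (Y σⁱ)`, and only `i = 1` contributes to
the derivative at `0`. [folklore] -/
theorem hasDerivAt_apply_mul_grassmannExp_smul_zero (φ : GrassmannAlgebra 𝕜 ι →ₗ[𝕜] 𝕜)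
    (Y : GrassmannAlgebra 𝕜 ι) {σ : GrassmannAlgebra 𝕜 ι} (hσ : IsNilpotent σ) :
    HasDerivAt (fun s : 𝕜 => φ (Y * grassmannExp (s • σ))) (φ (Y * σ)) 0 := by
  obtain ⟨k, hk⟩ := hσ
  have hK : σ ^ (k + 2) = 0 := pow_eq_zero_of_le (by omega) hk
  have hfun : (fun s : 𝕜 => φ (Y * grassmannExp (s • σ))) =
      fun s => ∑ i ∈ Finset.range (k + 2), (i.factorial : 𝕜)⁻¹ * s ^ i * φ (Y * σ ^ i) :=
    funext fun s => apply_mul_grassmannExp_smul_eq_sum φ Y hK s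
  rw [hfun]
  have he : ∀ i ∈ Finset.range (k + 2),
      HasDerivAt (fun s : 𝕜 => (i.factorial : 𝕜)⁻¹ * s ^ i * φ (Y * σ ^ i))
        ((i.factorial : 𝕜)⁻¹ * ((i : 𝕜) * (0 : 𝕜) ^ (i - 1)) * φ (Y * σ ^ i)) 0 := fun i _ =>
    ((hasDerivAt_pow i (0 : 𝕜)).const_mul _).mul_const _
  refine (HasDerivAt.fun_sum he).congr_deriv ?_
  rw [Finset.sum_eq_single 1 ?_ fun h => absurd (by simp) h]
  · simp
  · intro i _ hi
    rcases i with _ | _ | i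
    · simp
    · exact absurd rfl hi
    · simp

variable [LinearOrder ι] [Fintype ι]

/-- **The source derivative of a Gaussian Berezin functional (at `s = 0`).**  For every linear functional
`φ` on the complex-fermion Grassmann algebra, every `X` and all matrices `A` (action), `J` (source),
`d/ds|_{s=0} φ (X e^{ψ̄(A + sJ)ψ}) = φ (X ψ̄Jψ e^{ψ̄Aψ})`: the bilinear insertion `ψ̄Jψ` is the derivative
in the source strength (the generating-functional device of Berezin 1966, Ch. I §3 / Montvay–Münster 1994,
§4.1, for a bilinear source). [folklore] -/
theorem hasDerivAt_apply_mul_grassmannExp_quadratic_add_smul_zero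
    (φ : GrassmannAlgebra 𝕜 (ι ⊕ₗ ι) →ₗ[𝕜] 𝕜) (A J : Matrix ι ι 𝕜) (X : GrassmannAlgebra 𝕜 (ι ⊕ₗ ι)) :
    HasDerivAt (fun s : 𝕜 => φ (X * grassmannExp (quadratic 𝕜 (A + s • J))))
      (φ (X * quadratic 𝕜 J * grassmannExp (quadratic 𝕜 A))) 0 := by
  have hfun : (fun s : 𝕜 => φ (X * grassmannExp (quadratic 𝕜 (A + s • J)))) =
      fun s => φ (X * grassmannExp (quadratic 𝕜 A) * grassmannExp (s • quadratic 𝕜 J)) :=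
    funext fun s => by rw [grassmannExp_quadratic_add, quadratic_smul, mul_assoc]
  rw [hfun]
  refine (hasDerivAt_apply_mul_grassmannExp_smul_zero φ (X * grassmannExp (quadratic 𝕜 A))
    (isNilpotent_quadratic 𝕜 J)).congr_deriv ?_
  rw [mul_assoc, mul_assoc, (commute_quadratic 𝕜 J _).eq]

/-- **The source derivative of a Gaussian Berezin functional (at every `s₀`).**
`d/ds|_{s=s₀} φ (X e^{ψ̄(A + sJ)ψ}) = φ (X ψ̄Jψ e^{ψ̄(A + s₀J)ψ})` (shift `A ↦ A + s₀J` in the `s = 0`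
statement). [folklore] -/
theorem hasDerivAt_apply_mul_grassmannExp_quadratic_add_smul
    (φ : GrassmannAlgebra 𝕜 (ι ⊕ₗ ι) →ₗ[𝕜] 𝕜) (A J : Matrix ι ι 𝕜) (X : GrassmannAlgebra 𝕜 (ι ⊕ₗ ι))
    (s₀ : 𝕜) :
    HasDerivAt (fun s : 𝕜 => φ (X * grassmannExp (quadratic 𝕜 (A + s • J))))
      (φ (X * quadratic 𝕜 J * grassmannExp (quadratic 𝕜 (A + s₀ • J)))) s₀ := by
  have h0 : HasDerivAt (fun s : 𝕜 => φ (X * grassmannExp (quadratic 𝕜 (A + s₀ • J + s • J))))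
      (φ (X * quadratic 𝕜 J * grassmannExp (quadratic 𝕜 (A + s₀ • J)))) (s₀ - s₀) := by
    rw [sub_self]
    exact hasDerivAt_apply_mul_grassmannExp_quadratic_add_smul_zero φ (A + s₀ • J) J X
  have hfun : (fun s : 𝕜 => φ (X * grassmannExp (quadratic 𝕜 (A + s • J)))) =
      fun s => φ (X * grassmannExp (quadratic 𝕜 (A + s₀ • J + (s - s₀) • J))) := by
    funext s
    rw [add_assoc, ← add_smul, add_sub_cancel]
  rw [hfun]
  exact h0.comp_sub_const s₀ s₀

end NormedField

/-! ### Over `ℂ` with a real source strength -/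

section Complex

variable {ι : Type*} [LinearOrder ι] [Fintype ι]

/-- **The source derivative over `ℂ` with a real parameter (at `s = 0`).**  For every `ℂ`-linear
functional `φ` on the complex-fermion Grassmann algebra, every `X` and all complex matrices `A`, `J`,
the real function `s ↦ φ (X e^{ψ̄(A + sJ)ψ})` has derivative `φ (X ψ̄Jψ e^{ψ̄Aψ})` at `s = 0`. [folklore] -/
theorem hasDerivAt_apply_mul_grassmannExp_quadratic_add_ofReal_smul_zero
    (φ : GrassmannAlgebra ℂ (ι ⊕ₗ ι) →ₗ[ℂ] ℂ) (A J : Matrix ι ι ℂ) (X : GrassmannAlgebra ℂ (ι ⊕ₗ ι)) :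
    HasDerivAt (fun s : ℝ => φ (X * grassmannExp (quadratic ℂ (A + (s : ℂ) • J))))
      (φ (X * quadratic ℂ J * grassmannExp (quadratic ℂ A))) 0 := by
  have h := hasDerivAt_apply_mul_grassmannExp_quadratic_add_smul_zero φ A J X
  rw [← Complex.ofReal_zero] at h
  exact h.comp_ofReal

/-- **The source derivative over `ℂ` with a real parameter (at every `s₀`).**
`d/ds|_{s=s₀} φ (X e^{ψ̄(A + sJ)ψ}) = φ (X ψ̄Jψ e^{ψ̄(A + s₀J)ψ})` for real `s`. [folklore] -/
theorem hasDerivAt_apply_mul_grassmannExp_quadratic_add_ofReal_smul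
    (φ : GrassmannAlgebra ℂ (ι ⊕ₗ ι) →ₗ[ℂ] ℂ) (A J : Matrix ι ι ℂ) (X : GrassmannAlgebra ℂ (ι ⊕ₗ ι))
    (s₀ : ℝ) :
    HasDerivAt (fun s : ℝ => φ (X * grassmannExp (quadratic ℂ (A + (s : ℂ) • J))))
      (φ (X * quadratic ℂ J * grassmannExp (quadratic ℂ (A + (s₀ : ℂ) • J)))) s₀ :=
  (hasDerivAt_apply_mul_grassmannExp_quadratic_add_smul φ A J X (s₀ : ℂ)).comp_ofReal

end Complex

end Literature.MathematicalPhysics.QuantumLattice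

end
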